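import Literature.IUT.HodgeTheaters.BadLocalFrobenioidOfKitsDdash
import Mathlib.CategoryTheory.Limits.Preserves.Shapes.BinaryProducts
import Mathlib.CategoryTheory.ObjectProperty.Equivalence
import Mathlib.CategoryTheory.Adjunction.Limits
import HarnessLib

/-!
# [IUTchI] Example 3.2 (vi) (b) AT THE GENUINE BAD DATUM: `D^Θ_v̲` from `D_v̲`, reduced to (a) and the invariance of
# `Ÿ_v̲` — the slice transport over `Ÿ_v̲`

S. Mochizuki, *Inter-universal Teichmüller theory I*, kurims manuscript (May 2020), Example 3.2 (vi) p. 73: "(b) the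
category `D^Θ_v` may be reconstructed category-theoretically from `D_v` [cf. (a); the discussion at the beginning of
[EtTh], §5]" [claim: Mochizuki2012, status: disputed] (D-0012 claim key, series status DISPUTED — this file is a
PROOF-ONLY composition of landed constructions; nothing of the series is asserted; no side is taken on [IUTchIII] Cor.
3.12).  Example 3.2 (v) p. 72: "`D^Θ_v ⊆ (D_v)_{Ÿ_v}` … the full subcategory … determined by the products in `D_v` of
`Ÿ_v` with objects of `D⊢_v`" [cite: Mochizuki2012, I Ex 3.2 (v) p.72].  DAG node `IUTchI:Ex3.2(vi)` (decl
`BadLocalFrobenioid.DThetaFromD` among its decls, `Summits/ABC/IUTFork/DAGL5p.lean`), row E32vi/b of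
`plan/L5/SUBDAG-IUTchI-Ex32.md` (status before this file: "(γ) schema; at ofKits reduces to (a) + invariance of `Ÿ_v`
under self-equivalences of `D_v` — OPEN").

WHAT IS PROVED — exactly that reduction, in the kernel, for abc-iut-L5-t2's coset model of the bases
(`BadLocalFrobenioidBases.lean`: `D_v = CosetCat Π_v`, `Ÿ_v = ⟨Π_Ÿ⟩`, `D^Θ_v` the essential image of `A ↦ A^Θ := Ÿ_v × A`
in the slice `(D_v)_{Ÿ_v}`, with `prodIsLimit`: `Ÿ_v × A` IS a product):
* `BadLocalGroupDatum.essImage_prodFunctor_transport` — for a self-equivalence `e` of `D_v` preserving the essential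
  image of `D⊢_v` (clause (a), e.g. `incl_essImage_invariant_of_forall_map_ker` of `BadLocalFrobenioidOfKitsDdash.lean`)
  and an isomorphism `j : e(Ÿ_v) ≅ Ÿ_v`, the object `(e(X) → e(Ÿ_v) ≅ Ÿ_v)` of the slice lies in `D^Θ_v` whenever `X → Ÿ_v`
  does (`e` preserves the PRODUCTS `Ÿ_v × A`: Mathlib `mapIsLimitOfPreservesOfIsLimit` + `prodIsLimit` +
  `IsLimit.conePointsIsoOfNatIso`);
* `BadLocalGroupDatum.dThetaIncl_reconstructibleAlong_of_incl` — **(b) ⟸ (a) + «`e(Ÿ_v) ≅ Ÿ_v` for every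
  self-equivalence `e` of `D_v`»**: the self-equivalence `(D_v)_{Ÿ_v} ⥲ (D_v)_{e Ÿ_v} ⥲ (D_v)_{Ÿ_v}`
  (`Over.postEquiv e ⋙ Over.mapIso j`) restricts to `D^Θ_v` (Mathlib `Equivalence.congrFullSubcategory`) compatibly
  with `D^Θ_v → D_v`, i.e. abc-iut-L5-t2's `ReconstructibleAlong (dThetaIncl ⋙ Over.forget Ÿ_v)`;
* `BadLocalGroupDatum.nonempty_iso_ydd_of_forall_map_Y` — the invariance of `Ÿ_v` from its GROUP form «`φ(Π_Ÿ)` is a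
  conjugate of `Π_Ÿ` for every bicontinuous automorphism `φ` of `Π_v`» (tempered Galois-countable `Π_v`; abc-iut-L1's
  [FrdII] Thm. 2.4 (ii) engine) — the shape in which [EtTh] §2's characteristic nature of the covering `Ÿ̲̲ → X̲̲` enters
  (cf. abc-iut-L2's `DoubleUnderline.IotaStable`); DISPLAYED, never asserted
  [cite: MochizukiFrdII2008, Thm 2.4 (ii) p.21];
* `BadLocalFrobenioid.dThetaFromD_ofKits_of_ddashFromD` / `…_of_forall_map_ker` and
  `InitialThetaData.dThetaFromD_badLocalFrobenioidAt_of_forall_map_ker` /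
  `…badLocalFrobenioidAtDoubleUnderline_of_forall_map_ker` — **(vi)(b) for the assembly `ofKits`, AT THE GENUINE DATUM
  `badLocalFrobenioidAt` (initial Θ-data `D`, `v̲ = w ∣ v ∈ V(F)^bad`, `K_v̲ = K_w`) and AT THE [EtTh] §1 OBJECTS
  (`Π_v̲ := Π^tp_{X̲̲}`)**, modulo the two anabelian binders `hΔ` (tempered [AbsAnab] Lem. 1.3.8, as in (a)) and `hY`
  (group form of the invariance of `Π^tp_{Ÿ̲̲}`), both displayed.
No new definition, instance or notation (isomorphisms needed on the way are built inside proofs).  typed ≠ proved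
elsewhere; DISCHARGED here = proved as typed under OUR kernel, modulo the named hypotheses displayed in each signature.
-/

noncomputable section

namespace Literature.IUT.HodgeTheaters

open CategoryTheory CategoryTheory.Limits Literature.AnabelianGeometry.SemiGraphs Literature.AlgebraicGeometry.Frobenioids
open Literature.AlgebraicGeometry.Frobenioids.PadicFrd Literature.AnabelianGeometry.EtaleTheta Topology

universe u

namespace BadLocalGroupDatum

variable {G : Type u} [Group G] [TopologicalSpace G] {P : Type u} [Group P] [TopologicalSpace P]
  (T : BadLocalGroupDatum G P)

/-! ### §1 Objects of `CosetCat Π_v` with conjugate subgroups are isomorphic -/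

/-- In the coset category, `Π/H ≅ Π/H'` as soon as `H' = a⁻¹·H·a` for some `a ∈ Π` (the isomorphism `gH ↦ g a H'`).
[cite: MochizukiSemiAnbd2006, Def 3.1(i) p.33] -/
theorem nonempty_iso_of_conj (X Y : CosetCat P) (a : P) (h : ∀ g : P, g ∈ X.sg ↔ a⁻¹ * g * a ∈ Y.sg) :
    Nonempty (X ≅ Y) := by
  have hXY : ∀ u ∈ X.sg, u • ((a : P) : Y.carrier) = ((a : P) : Y.carrier) := fun u hu => by
    rw [MulAction.Quotient.smul_coe, smul_eq_mul]
    refine QuotientGroup.eq.mpr ?_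
    rw [show (u * a)⁻¹ * a = a⁻¹ * u⁻¹ * a by group]
    exact (h u⁻¹).1 (X.sg.inv_mem hu)
  have hYX : ∀ u ∈ Y.sg, u • ((a⁻¹ : P) : X.carrier) = ((a⁻¹ : P) : X.carrier) := fun u hu => by
    rw [MulAction.Quotient.smul_coe, smul_eq_mul]
    refine QuotientGroup.eq.mpr ?_
    rw [show (u * a⁻¹)⁻¹ * a⁻¹ = a * u⁻¹ * a⁻¹ by group]
    refine (h (a * u⁻¹ * a⁻¹)).2 ?_
    rw [show a⁻¹ * (a * u⁻¹ * a⁻¹) * a = u⁻¹ by group]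
    exact Y.sg.inv_mem hu
  refine ⟨⟨CosetCat.homMk ((a : P) : Y.carrier) hXY, CosetCat.homMk ((a⁻¹ : P) : X.carrier) hYX, ?_, ?_⟩⟩
  · apply CosetCat.hom_ext
    rw [CosetCat.pt_comp, CosetCat.pt_homMk, CosetCat.homMk_toFun_coe, MulAction.Quotient.smul_coe, smul_eq_mul,
      mul_inv_cancel, CosetCat.pt_id]
  · apply CosetCat.hom_ext
    rw [CosetCat.pt_comp, CosetCat.pt_homMk, CosetCat.homMk_toFun_coe, MulAction.Quotient.smul_coe, smul_eq_mul,
      inv_mul_cancel, CosetCat.pt_id]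

/-- **The invariance of `Ÿ_v` from its GROUP form.**  For `Π_v` TEMPERED and Galois-countable: if every bicontinuous
automorphism `φ` of `Π_v` carries `Π_Ÿ` onto a conjugate of `Π_Ÿ` (`hY`), then every self-equivalence `e` of
`D_v = CosetCat Π_v` satisfies `e(Ÿ_v) ≅ Ÿ_v` (abc-iut-L1's [FrdII] Thm. 2.4 (ii) engine: `e` acts on objects through some
bicontinuous `φ` up to conjugacy). [cite: MochizukiFrdII2008, Thm 2.4 (ii) p.21] -/
theorem nonempty_iso_ydd_of_forall_map_Y [IsTopologicalGroup P] [SecondCountableTopology P] (hP : IsTempered P)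
    (hY : ∀ φ : P ≃ₜ* P, ∃ d : P, ∀ g : P, g ∈ T.Y ↔ d⁻¹ * φ g * d ∈ T.Y) (e : T.Dv ≌ T.Dv) :
    Nonempty (e.functor.obj T.ydd ≅ T.ydd) := by
  obtain ⟨φ, hφ⟩ :=
    BaseGaloisSystem.exists_continuousMulEquiv_forall_obj_conj_of_cosetCat_equivalence hP hP
      (E := (e : CosetCat P ≌ CosetCat P))
  obtain ⟨c, hc⟩ := hφ T.ydd
  obtain ⟨d, hd⟩ := hY φ
  -- `φ(Π_Ÿ) = c·(e Ÿ).sg·c⁻¹` and `φ(Π_Ÿ) = d·Π_Ÿ·d⁻¹`, so `(e Ÿ).sg = a⁻¹·Π_Ÿ·a` with `a := d⁻¹ * c`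
  refine (nonempty_iso_of_conj _ _ (d⁻¹ * c) fun x => ?_).map Iso.symm
  have key : (d⁻¹ * c)⁻¹ * x * (d⁻¹ * c) = c⁻¹ * φ (φ.symm (d * x * d⁻¹)) * c := by
    rw [ContinuousMulEquiv.apply_symm_apply]; group
  have hdx : x ∈ T.Y ↔ φ.symm (d * x * d⁻¹) ∈ T.Y := by
    rw [hd (φ.symm (d * x * d⁻¹)), ContinuousMulEquiv.apply_symm_apply,
      show d⁻¹ * (d * x * d⁻¹) * d = x by group]
  rw [key]
  exact hdx.trans (hc _)

/-! ### §2 The products `Ÿ_v × A` are transported by a self-equivalence fixing `Ÿ_v` and `D⊢_v` up to isomorphism -/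

/-- **Transport of `A^Θ = (Ÿ_v × A → Ÿ_v)`**: for a self-equivalence `e` of `D_v`, `j : e(Ÿ_v) ≅ Ÿ_v` and
`k : e(A) ≅ A'` (`A, A' ∈ D⊢_v`), the slice object `(e(Ÿ_v × A) → e(Ÿ_v) ≅ Ÿ_v)` is isomorphic over `Ÿ_v` to `A'^Θ` —
because `Ÿ_v × A` IS a product in `D_v` (`prodIsLimit`) and `e` preserves it.
[cite: Mochizuki2012, I Ex 3.2 (v) p.72] -/
theorem nonempty_iso_prodOver_transport (e : T.Dv ≌ T.Dv) (j : e.functor.obj T.ydd ≅ T.ydd) (V V' : T.Ddash)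
    (k : e.functor.obj (T.incl.obj V) ≅ T.incl.obj V') :
    Nonempty ((Over.mk (e.functor.map (T.prodFst V) ≫ j.hom) : Over T.ydd) ≅ T.prodOver V') := by
  -- `e(Ÿ × A)` with `(e pr₁, e pr₂)` is a product of `e Ÿ`, `e A`
  have hlim : IsLimit (BinaryFan.mk (e.functor.map (T.prodFst V)) (e.functor.map (T.prodSnd V))) :=
    mapIsLimitOfPreservesOfIsLimit e.functor _ _ (T.prodIsLimit V)
  -- compare with the product `Ÿ × A'` along `(j, k)`
  refine ⟨Over.isoMk (IsLimit.conePointsIsoOfNatIso hlim (T.prodIsLimit V') (mapPairIso j k)) ?_⟩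
  have h := IsLimit.conePointsIsoOfNatIso_hom_comp hlim (T.prodIsLimit V') (mapPairIso j k) ⟨WalkingPair.left⟩
  have h2 : (BinaryFan.mk (e.functor.map (T.prodFst V)) (e.functor.map (T.prodSnd V))).π.app ⟨WalkingPair.left⟩ =
      e.functor.map (T.prodFst V) := rfl
  have h3 : (mapPairIso (F := pair (e.functor.obj T.ydd) (e.functor.obj (T.incl.obj V)))
      (G := pair T.ydd (T.incl.obj V')) j k).hom.app ⟨WalkingPair.left⟩ = j.hom := rfl
  rw [h2, h3] at h
  exact h

/-- **The essential image of `A ↦ A^Θ` is carried into itself** by `X ↦ (e(X) → e(Ÿ_v) ≅ Ÿ_v)` whenever the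
self-equivalence `e` of `D_v` preserves the essential image of `D⊢_v` (clause (a)) and `j : e(Ÿ_v) ≅ Ÿ_v`.
[cite: Mochizuki2012, I Ex 3.2 (v) p.72] -/
theorem essImage_prodFunctor_transport (e : T.Dv ≌ T.Dv) (j : e.functor.obj T.ydd ≅ T.ydd)
    (hinv : ∀ A : T.Ddash, T.incl.essImage (e.functor.obj (T.incl.obj A)))
    (X : Over T.ydd) (hX : T.prodFunctor.essImage X) :
    T.prodFunctor.essImage (Over.mk (e.functor.map X.hom ≫ j.hom) : Over T.ydd) := by
  obtain ⟨V, ⟨i⟩⟩ := hX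
  obtain ⟨V', ⟨k⟩⟩ := hinv V
  obtain ⟨ψ⟩ := T.nonempty_iso_prodOver_transport e j V V' k.symm
  -- `(e X → Ÿ) ≅ (e (Ÿ × A) → Ÿ)` along `e(i)`
  have hil : i.inv.left ≫ T.prodFst V = X.hom := Over.w i.inv
  have ρ : (Over.mk (e.functor.map X.hom ≫ j.hom) : Over T.ydd) ≅ Over.mk (e.functor.map (T.prodFst V) ≫ j.hom) :=
    Over.isoMk (e.functor.mapIso ((Over.forget T.ydd).mapIso i.symm)) (by
      change e.functor.map i.inv.left ≫ e.functor.map (T.prodFst V) ≫ j.hom = e.functor.map X.hom ≫ j.hom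
      rw [← Category.assoc, ← e.functor.map_comp, hil])
  exact Functor.essImage.ofIso (ρ ≪≫ ψ).symm (T.prodFunctor.obj_mem_essImage V')

/-! ### §3 (b) ⟸ (a) + invariance of `Ÿ_v`: the slice transport restricted to `D^Θ_v` -/

/-- On objects, the slice transport `(D_v)_{Ÿ_v} ⥲ (D_v)_{e Ÿ_v} ⥲ (D_v)_{Ÿ_v}` is `X ↦ (e X → e Ÿ_v ≅ Ÿ_v)`.
[cite: Mochizuki2012, I Ex 3.2 (v) p.72] -/
theorem nonempty_iso_sliceTransport_obj (e : T.Dv ≌ T.Dv) (j : e.functor.obj T.ydd ≅ T.ydd) (X : Over T.ydd) :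
    Nonempty (((Over.postEquiv (X := T.ydd) e).trans (Over.mapIso j)).functor.obj X ≅
      Over.mk (e.functor.map X.hom ≫ j.hom)) :=
  ⟨Over.isoMk (Iso.refl _) (by
    change 𝟙 _ ≫ (e.functor.map X.hom ≫ j.hom) = e.functor.map X.hom ≫ j.hom
    rw [Category.id_comp])⟩

/-- On objects, the INVERSE slice transport is `Y ↦ (e⁻¹ Y → e⁻¹ Ÿ_v ≅ Ÿ_v)` for the induced `e⁻¹ Ÿ_v ≅ Ÿ_v`.
[cite: Mochizuki2012, I Ex 3.2 (v) p.72] -/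
theorem nonempty_iso_sliceTransport_inverse_obj (e : T.Dv ≌ T.Dv) (j : e.functor.obj T.ydd ≅ T.ydd)
    (Y : Over T.ydd) :
    Nonempty (((Over.postEquiv (X := T.ydd) e).trans (Over.mapIso j)).inverse.obj Y ≅
      Over.mk (e.symm.functor.map Y.hom ≫ (e.inverse.mapIso j.symm ≪≫ (e.unitIso.app T.ydd).symm).hom)) :=
  ⟨Over.isoMk (Iso.refl _) (by
    change 𝟙 _ ≫ (e.inverse.map Y.hom ≫ (e.inverse.map j.inv ≫ e.unitIso.inv.app T.ydd)) =
      e.inverse.map (Y.hom ≫ j.inv) ≫ e.unitIso.inv.app T.ydd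
    rw [Category.id_comp, Functor.map_comp, Category.assoc])⟩

/-- **[IUTchI] Ex. 3.2 (vi) (b) REDUCED TO (a) + the invariance of `Ÿ_v`** (SUBDAG row E32vi/b's reading, in the
kernel): for a bad-place group datum `T` (coset model of the bases), IF `D⊢_v ⊆ D_v` is reconstructible from `D_v`
(`ReconstructibleAlong T.incl` = clause (a), [AbsAnab] Lem. 1.3.8) AND every self-equivalence of `D_v` fixes `Ÿ_v` up to
isomorphism (`hY`; [EtTh] §2/§5: the covering `Ÿ_v → X̲̲_v` is characteristic), THEN `D^Θ_v → D_v` is reconstructible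
from `D_v` (`ReconstructibleAlong (dThetaIncl ⋙ Over.forget Ÿ_v)`): the lift is the slice transport restricted to
`D^Θ_v`. ([IUTchI] Ex 3.2 (vi) (b) p.73) [claim: Mochizuki2012, status: disputed] -/
theorem dThetaIncl_reconstructibleAlong_of_incl (hD : ReconstructibleAlong T.incl)
    (hY : ∀ e : T.Dv ≌ T.Dv, Nonempty (e.functor.obj T.ydd ≅ T.ydd)) :
    ReconstructibleAlong (T.dThetaIncl ⋙ Over.forget T.ydd) := by
  intro e
  obtain ⟨j⟩ := hY e
  have hinv : ∀ (e' : T.Dv ≌ T.Dv) (A : T.Ddash), T.incl.essImage (e'.functor.obj (T.incl.obj A)) :=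
    fun e' A => essImage_invariant_of_reconstructibleAlong T.incl hD e' A
  -- the slice transport and its effect on the essential image of `A ↦ A^Θ`
  let E₁ : Over T.ydd ≌ Over T.ydd := (Over.postEquiv (X := T.ydd) e).trans (Over.mapIso j)
  have hfwd : ∀ X : Over T.ydd, T.prodFunctor.essImage X → T.prodFunctor.essImage (E₁.functor.obj X) := by
    intro X hX
    obtain ⟨ι⟩ := T.nonempty_iso_sliceTransport_obj e j X
    exact Functor.essImage.ofIso ι.symm (T.essImage_prodFunctor_transport e j (hinv e) X hX)
  have hbwd : ∀ Y : Over T.ydd, T.prodFunctor.essImage Y → T.prodFunctor.essImage (E₁.inverse.obj Y) := by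
    intro Y hY'
    obtain ⟨ι⟩ := T.nonempty_iso_sliceTransport_inverse_obj e j Y
    exact Functor.essImage.ofIso ι.symm
      (T.essImage_prodFunctor_transport e.symm (e.inverse.mapIso j.symm ≪≫ (e.unitIso.app T.ydd).symm)
        (hinv e.symm) Y hY')
  have hP : T.prodFunctor.essImage.inverseImage E₁.functor = T.prodFunctor.essImage := by
    ext X
    constructor
    · intro h
      exact T.prodFunctor.essImage.prop_of_iso (E₁.unitIso.app X).symm (hbwd _ h)
    · intro h
      exact hfwd X h
  -- restrict to `D^Θ_v`
  refine ⟨Equivalence.congrFullSubcategory E₁ hP, ⟨NatIso.ofComponents (fun X => Iso.refl _) ?_⟩⟩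
  intro X Y f
  simp only [Functor.comp_map, Iso.refl_hom]
  rfl

end BadLocalGroupDatum

/-! ### §4 (vi)(b) for the assembly `BadLocalFrobenioid.ofKits` -/

namespace BadLocalFrobenioid

variable {p : ℕ} [Fact p.Prime] (l : ℕ) (d : GaloisValDatum.{0} p) {P : Type} [Group P] [TopologicalSpace P]
  (T : BadLocalGroupDatum d.Gal P) (q qroot : intNonzero d.k) (hpow : qroot ^ (2 * l) = q) (hq : ¬ IsUnit qroot)
  {Fv : Type} [Category.{0} Fv] {Fbirat : Type} [Category.{0} Fbirat] {Cv : Type} [Category.{0} Cv]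
  (K : TemperedThetaInput d T hq Fv Fbirat Cv)

/-- **[IUTchI] Ex. 3.2 (vi) (b) for the assembly `ofKits`, from (a)**: `DThetaFromD ⟸ DdashFromD` + «`e(Ÿ_v) ≅ Ÿ_v` for
every self-equivalence `e` of `D_v`» — print's "[cf. (a); … [EtTh], §5]" as a kernel implication at the coset model.
([IUTchI] Ex 3.2 (vi) (b) p.73) [claim: Mochizuki2012, status: disputed] -/
theorem dThetaFromD_ofKits_of_ddashFromD (hD : (ofKits l d T q qroot hpow hq K).DdashFromD)
    (hY : ∀ e : T.Dv ≌ T.Dv, Nonempty (e.functor.obj T.ydd ≅ T.ydd)) :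
    (ofKits l d T q qroot hpow hq K).DThetaFromD :=
  T.dThetaIncl_reconstructibleAlong_of_incl hD hY

/-- **[IUTchI] Ex. 3.2 (vi) (b) for `ofKits` on a TEMPERED Galois-countable `Π_v`, in GROUP form**: modulo the two
anabelian binders `hΔ` ([AbsAnab] Lem. 1.3.8, tempered unfolded form — as in (a)) and `hY` («`φ(Π_Ÿ)` is a conjugate of
`Π_Ÿ` for every bicontinuous automorphism `φ` of `Π_v`», the characteristic nature of the covering `Ÿ_v → X̲̲_v`),
`D^Θ_v` is reconstructible from `D_v`. ([IUTchI] Ex 3.2 (vi) (b) p.73) [claim: Mochizuki2012, status: disputed] -/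
theorem dThetaFromD_ofKits_of_forall_map_ker [IsTopologicalGroup P] [SecondCountableTopology P]
    (hP : IsTempered P) (hΔ : ∀ φ : P ≃ₜ* P, T.aug.ker.map φ.toMulEquiv.toMonoidHom = T.aug.ker)
    (hY : ∀ φ : P ≃ₜ* P, ∃ c : P, ∀ g : P, g ∈ T.Y ↔ c⁻¹ * φ g * c ∈ T.Y) :
    (ofKits l d T q qroot hpow hq K).DThetaFromD :=
  dThetaFromD_ofKits_of_ddashFromD l d T q qroot hpow hq K
    (ddashFromD_ofKits_of_forall_map_ker l d T q qroot hpow hq K hP hΔ) (T.nonempty_iso_ydd_of_forall_map_Y hP hY)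

end BadLocalFrobenioid

/-! ### §5 (vi)(b) for the initial Θ-datum at `v̲ = w ∣ v ∈ V(F)^bad` and AT THE [EtTh] §1 OBJECTS -/

section Datum

open NumberField IsDedekindDomain

variable {F K Fbar : Type} [Field F] [NumberField F] [Field K] [NumberField K] [Algebra F K]
  [Field Fbar] [Algebra F Fbar] [Algebra K Fbar] [IsScalarTower F K Fbar] {E : WeierstrassCurve F}
  [E.IsElliptic] {l : ℕ} {Pb : BadPlacePredicates K} (D : InitialThetaData F K Fbar E l Pb)
  {v : FinitePlace F} (hv : v ∈ D.VFbad) (w : HeightOneSpectrum (𝓞 K)) [w.asIdeal.LiesOver v.maximalIdeal.asIdeal]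
  (p : ℕ) [Fact p.Prime] (hw : ((p : ℕ) : 𝓞 K) ∈ w.asIdeal)

namespace InitialThetaData

/-- **[IUTchI] Ex. 3.2 (vi) (b) AT THE GENUINE DATUM** `badLocalFrobenioidAt` (`K_v̲ = K_w`, genuine `q_v̲`, `q̲_v̲`,
`C⊢_v̲`), for EVERY input group datum on a TEMPERED Galois-countable `Π_v̲` and EVERY tempered-side input `Kt`, modulo
the anabelian binders `hΔ` (as in (a)) and `hY` (invariance of `Π_Ÿ` up to conjugacy): `D^Θ_v̲` is reconstructible
category-theoretically from `D_v̲`. ([IUTchI] Ex 3.2 (vi) (b) p.73) [claim: Mochizuki2012, status: disputed] -/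
theorem dThetaFromD_badLocalFrobenioidAt_of_forall_map_ker {P : Type} [Group P] [TopologicalSpace P]
    [IsTopologicalGroup P] [SecondCountableTopology P]
    (T : BadLocalGroupDatum (GaloisValDatum.ofPlace K p w hw).Gal P) {Fv : Type} [Category.{0} Fv] {Fbirat : Type}
    [Category.{0} Fbirat] {Cv : Type} [Category.{0} Cv]
    (Kt : TemperedThetaInput (GaloisValDatum.ofPlace K p w hw) T (D.qRootAt_not_isUnit hv w p hw) Fv Fbirat Cv)
    (hP : IsTempered P) (hΔ : ∀ φ : P ≃ₜ* P, T.aug.ker.map φ.toMulEquiv.toMonoidHom = T.aug.ker)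
    (hY : ∀ φ : P ≃ₜ* P, ∃ c : P, ∀ g : P, g ∈ T.Y ↔ c⁻¹ * φ g * c ∈ T.Y) :
    (D.badLocalFrobenioidAt hv w p hw T Kt).DThetaFromD :=
  BadLocalFrobenioid.dThetaFromD_ofKits_of_forall_map_ker l _ T _ _ _ _ Kt hP hΔ hY

variable {S : ThetaSetting p} {ES : S.EtaleThetaData} (dGL : S.toTemperedCurve.GroupLevelData) (hS2 : S.Sec2Hyps)
  (C : ES.DoubleUnderline l) (ι : ↥S.GK ≃ₜ* (GaloisValDatum.ofPlace K p w hw).Gal)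
  {Fv : Type} [Category.{0} Fv] {Fbirat : Type} [Category.{0} Fbirat] {Cv : Type} [Category.{0} Cv]
  (Kt : TemperedThetaInput (GaloisValDatum.ofPlace K p w hw) (badGroupDatumOfDoubleUnderline w p hw dGL hS2 C ι)
    (D.qRootAt_not_isUnit hv w p hw) Fv Fbirat Cv)

/-- **[IUTchI] Ex. 3.2 (vi) (b) AT THE GENUINE DATUM over the GENUINE [EtTh] §1 group datum** (`Π_v̲ := Π^tp_{X̲̲}`,
`Π_Ÿ := Π^tp_{Ÿ̲̲} = Π^tp_Ÿ ∩ Π^tp_{X̲̲}`; tempered and Galois-countable are THEOREMS): modulo EXACTLY the two anabelian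
binders, both `ι`-free — `hΔ` («`Δ^tp_{X̲̲} = Δ^tp_X ∩ Π^tp_{X̲̲}` is characteristic in `Π^tp_{X̲̲}`», [AbsAnab] Lem. 1.3.8) and
`hY` («`Π^tp_{Ÿ̲̲}` is carried onto a conjugate of itself by every bicontinuous automorphism of `Π^tp_{X̲̲}`», [EtTh] §2) —
`D^Θ_v̲` is reconstructible category-theoretically from `D_v̲ = 𝓑^temp(X̲̲_v̲)⁰`.
([IUTchI] Ex 3.2 (vi) (b) p.73) [claim: Mochizuki2012, status: disputed] -/
theorem dThetaFromD_badLocalFrobenioidAtDoubleUnderline_of_forall_map_ker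
    (hΔ : ∀ φ : ↥C.Huu ≃ₜ* ↥C.Huu,
      (S.aug.toMonoidHom.ker.subgroupOf C.Huu).map φ.toMulEquiv.toMonoidHom =
        S.aug.toMonoidHom.ker.subgroupOf C.Huu)
    (hY : ∀ φ : ↥C.Huu ≃ₜ* ↥C.Huu, ∃ c : ↥C.Huu, ∀ g : ↥C.Huu,
      g ∈ BadLocalGroupDatum.Ydduu hS2 C ↔ c⁻¹ * φ g * c ∈ BadLocalGroupDatum.Ydduu hS2 C) :
    (D.badLocalFrobenioidAtDoubleUnderline hv w p hw dGL hS2 C ι Kt).DThetaFromD := by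
  haveI := BadLocalGroupDatum.secondCountableTopology_Huu dGL C
  refine D.dThetaFromD_badLocalFrobenioidAt_of_forall_map_ker hv w p hw _ Kt
    (BadLocalGroupDatum.isTempered_Huu dGL C) (fun φ => ?_) hY
  rw [BadLocalGroupDatum.ker_aug_ofDoubleUnderline]
  exact hΔ φ

end InitialThetaData

end Datum

end Literature.IUT.HodgeTheaters

end
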